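import Summits.CriticalPhenomena.PercolationContinuityZ3.Theorems.PercNearOneGluingNoHeavyLowerTailCSHDefs
import HarnessLib

/-!
# The POCKET conditioned slack hierarchy PCSH — DEFINITIONS (towards Kozma–Nitzan's Question 8 for every relay set)

Definitions file (`--supports stmt-CriticalPhenomena-4575`, closed crux; independent mathematics), prover `prim-ineq-gen-7`
(gen 10).  Memo `run/shared/lean/prim/prim-ineq-gen-7/FINDING-Q8-POCKET-g10.md` §3.  No named facts, no sorries; standard axioms.

Kozma–Nitzan (arXiv:2401.12397, §5.5 p. 36) QUESTION 8 designates the relay `c ∈ A` minimising `P(a ↔ b, 0 ↮ A)` and asks for the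
pre-FKG inequality (41) `P(0 ↔ b, 0 ↔ A) ≥ P(0 ↔ A, c ↔ b)`.  More generally (prim-lf-2's "master designation", proved at `|A| = 2` in
`…KnDesignationTwoRelays.lean`) one designates by `∫_P F(C_a)` for a DECREASING POCKET EVENT `P = {C_0 ∈ 𝒟}` (`𝒟` a down-closed family of
vertex sets), e.g. `𝒟 = {S | S ∩ A = ∅}` (Question 8) or `𝒟 = {S | S ⊆ {0}}` (Question 9).  The cell's proof of Questions 7 and 9 for every
`|A|` runs through the conditioned slack hierarchy `CSH` (`…CSHDefs.lean`, prim-hp-8) resp. its hub version (`MixCSH`); THIS FILE defines the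
POCKET version, in which every label except the first observer `o` carries the pocket event and every constant is conditioned on it:

* `pocketEv o 𝒟 = {ω | openCluster ω o ∈ 𝒟}` — the pocket event `P`;
* `pAvoidConst w o 𝒟 d A u` — the decoy constants: `μ(d ↮ A, d ↔ o) / μ({d ↮ A} ∩ P)` at `u = o` and `μ({d ↮ A} ∩ P ∩ {d ↔ u}) / μ({d ↮ A} ∩ P)`
  at `u ≠ o`; `pDecoyList w o 𝒟 A D` — the list `[(d_j, c_j)]` with growing avoided sets (as `CSH.decoyList`);
* `pObsConst w o 𝒟 v A = μ(v ↮ A, v ↔ o) / μ({v ↮ A} ∩ P)` — the observers' constant `p`;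
* `pCovD w o 𝒟 x Y g u` — the denominator-free pocket-centred bracket: with `N = {x ↮ Y}`, `R = N ∩ P` (the reference event) and
  `A_o = N ∩ {x ↔ o}`, `A_u = N ∩ P ∩ {x ↔ u}` (`u ≠ o`):  `μ(R)·∫_{A_u} g − μ(A_u)·∫_R g`  (`= μ(R)·μ(A_u)·(E[g | A_u] − E[g | R])`);
* `pcshMargin w o 𝒟 x Y D v g = cshMarg (pDecoyList …) (pObsConst …) o v (pCovD … g)` and the statement `PCSHHolds w o 𝒟 x Y D v`: the
  margin is `≥ 0` (i) for every integrand `F(C_x) − F(C_c)` with `F` a monotone vertex-set functional and `c ∈ Y`, and (ii) for every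
  monotone functional `f` of the open edge cluster of `x` (the case `Ψ_iso = 1{C_x ≠ ∅}` gives the pocket "Lemma AC").
For `𝒟 = 𝒫(V)` (no pocket) these are `CSH.avoidConst/decoyList/obsConst` and `μ(N)·CSH.covD`-shaped brackets.  The sequel
`…PocketCSHPreMargin.lean` proves: `PCSHHolds` for all data ⟹ (41) for the pocket designee for EVERY `|A|` (census of the hierarchy,
levels 0–3: 0 violations in > 6 000 exact instances; memo §3).
[cite: KozmaNitzan2024, Question 8 (§5.5 p. 36), Conj. 4 (p. 32)] [cite: VandenbergHaggstromKahn2005, Thm. 1.3 (p. 6)]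
-/

noncomputable section

namespace Summit.CriticalPhenomena.PercolationContinuityZ3.Theorems

open MeasureTheory Set Literature.Probability.LatticeModels Literature.Probability.Percolation
open scoped Classical

namespace PocketCSH

variable {V : Type*}

/-- The pocket event `P = {C_o ∈ 𝒟}` of the first observer (`𝒟` a family of vertex sets; decreasing when `𝒟` is down-closed).
(transcription of the cell memo prim-ineq-gen-7 FINDING-Q8-POCKET-g10.md §3) [cite: KozmaNitzan2024, Question 8 (§5.5 p. 36)] -/
def pocketEv (o : V) (𝒟 : Set (Set V)) : Set (BondConfig V) := {ω | openCluster ω o ∈ 𝒟}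

/-- The pocket decoy constant of a decoy `d` with avoided set `A`: at the label `o`, `μ(d ↮ A, d ↔ o) / μ({d ↮ A} ∩ P)`; at a label
`u ≠ o`, `μ({d ↮ A} ∩ P ∩ {d ↔ u}) / μ({d ↮ A} ∩ P)`. (transcription of the cell memo prim-ineq-gen-7 FINDING-Q8-POCKET-g10.md §3) [folklore] -/
def pAvoidConst (w : Sym2 V → unitInterval) (o : V) (𝒟 : Set (Set V)) (d : V) (A : Set V) : V → ℝ := fun u =>
  if u = o then
    (prodBernoulli w).real ({ω : BondConfig V | ∀ a ∈ A, ¬ (openGraph ω).Reachable d a} ∩ openConn d o) /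
      (prodBernoulli w).real ({ω : BondConfig V | ∀ a ∈ A, ¬ (openGraph ω).Reachable d a} ∩ pocketEv o 𝒟)
  else
    (prodBernoulli w).real ({ω : BondConfig V | ∀ a ∈ A, ¬ (openGraph ω).Reachable d a} ∩ pocketEv o 𝒟 ∩ openConn d u) /
      (prodBernoulli w).real ({ω : BondConfig V | ∀ a ∈ A, ¬ (openGraph ω).Reachable d a} ∩ pocketEv o 𝒟)

/-- The pocket decoy/constant list: decoys `d_1, …, d_k` in order, the `j`-th constant with avoided set `A ∪ {d_1, …, d_{j-1}}`
(as `CSH.decoyList`, with `pAvoidConst`). (transcription of the cell memo prim-ineq-gen-7 FINDING-Q8-POCKET-g10.md §3) [folklore] -/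
def pDecoyList (w : Sym2 V → unitInterval) (o : V) (𝒟 : Set (Set V)) : Set V → List V → List (V × (V → ℝ))
  | _, [] => []
  | A, d :: ds => (d, pAvoidConst w o 𝒟 d A) :: pDecoyList w o 𝒟 (insert d A) ds

/-- The pocket observers' constant `p = μ(v ↮ A, v ↔ o) / μ({v ↮ A} ∩ P)` (`A` = owner ∪ avoided set ∪ all decoys).
(transcription of the cell memo prim-ineq-gen-7 FINDING-Q8-POCKET-g10.md §3) [folklore] -/
def pObsConst (w : Sym2 V → unitInterval) (o : V) (𝒟 : Set (Set V)) (v : V) (A : Set V) : ℝ :=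
  (prodBernoulli w).real ({ω : BondConfig V | ∀ a ∈ A, ¬ (openGraph ω).Reachable v a} ∩ openConn v o) /
    (prodBernoulli w).real ({ω : BondConfig V | ∀ a ∈ A, ¬ (openGraph ω).Reachable v a} ∩ pocketEv o 𝒟)

/-- The denominator-free pocket-centred bracket of an integrand `g`: with `N = {x ↮ Y}`, `R = N ∩ P`, `A_o = N ∩ {x ↔ o}` and
`A_u = N ∩ P ∩ {x ↔ u}` for `u ≠ o`:  `pCovD g u = μ(R)·∫_{A_u} g − μ(A_u)·∫_R g`.
(transcription of the cell memo prim-ineq-gen-7 FINDING-Q8-POCKET-g10.md §3) [folklore] -/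
def pCovD (w : Sym2 V → unitInterval) (o : V) (𝒟 : Set (Set V)) (x : V) (Y : Set V) (g : BondConfig V → ℝ) (u : V) : ℝ :=
  (prodBernoulli w).real ({ω : BondConfig V | ∀ y ∈ Y, ¬ (openGraph ω).Reachable x y} ∩ pocketEv o 𝒟) *
      (∫ ω in {ω : BondConfig V | ∀ y ∈ Y, ¬ (openGraph ω).Reachable x y} ∩ (if u = o then univ else pocketEv o 𝒟) ∩ openConn x u,
        g ω ∂(prodBernoulli w)) -
    (prodBernoulli w).real ({ω : BondConfig V | ∀ y ∈ Y, ¬ (openGraph ω).Reachable x y} ∩ (if u = o then univ else pocketEv o 𝒟) ∩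
        openConn x u) *
      ∫ ω in {ω : BondConfig V | ∀ y ∈ Y, ¬ (openGraph ω).Reachable x y} ∩ pocketEv o 𝒟, g ω ∂(prodBernoulli w)

/-- **The margin of PCSH(Y; x; d_1..d_k; o, v; 𝒟)[g]** (level forms of `…CSHDefs.lean` with the pocket constants).
(transcription of the cell memo prim-ineq-gen-7 FINDING-Q8-POCKET-g10.md §3) [folklore] -/
def pcshMargin (w : Sym2 V → unitInterval) (o : V) (𝒟 : Set (Set V)) (x : V) (Y : Set V) (D : List V) (v : V)
    (g : BondConfig V → ℝ) : ℝ :=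
  CSH.cshMarg (pDecoyList w o 𝒟 (insert x Y) D) (pObsConst w o 𝒟 v (insert x Y ∪ {d | d ∈ D})) o v (pCovD w o 𝒟 x Y g)

/-- **The pocket conditioned slack hierarchy statement PCSH(Y; x; D; o, v; 𝒟)**: the margin is nonnegative (i) for every integrand
`F(C_x) − F(C_c)` with `F` monotone on vertex sets and `c ∈ Y`, and (ii) for every monotone functional of the open edge cluster of `x`.
(Conjecture of the cell memo; exact census levels 0–3, 0 violations.)
(transcription of the cell memo prim-ineq-gen-7 FINDING-Q8-POCKET-g10.md §3) [cite: KozmaNitzan2024, Question 8 (§5.5 p. 36)] -/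
def PCSHHolds (w : Sym2 V → unitInterval) (o : V) (𝒟 : Set (Set V)) (x : V) (Y : Set V) (D : List V) (v : V) : Prop :=
  (∀ F : Set V → ℝ, (∀ S S' : Set V, S ⊆ S' → F S ≤ F S') → ∀ c ∈ Y,
      0 ≤ pcshMargin w o 𝒟 x Y D v (fun ω => F (openCluster ω x) - F (openCluster ω c))) ∧
    (∀ f : Set (Sym2 V) → ℝ, Monotone f → 0 ≤ pcshMargin w o 𝒟 x Y D v (fun ω => f (openEdgeCluster ω x)))

/-! ### Elementary unfolding lemmas -/

/-- Membership in the pocket event. [folklore] -/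
@[simp] theorem mem_pocketEv (o : V) (𝒟 : Set (Set V)) (ω : BondConfig V) : ω ∈ pocketEv o 𝒟 ↔ openCluster ω o ∈ 𝒟 := Iff.rfl

/-- `pDecoyList` on a cons. [folklore] -/
@[simp] theorem pDecoyList_cons (w : Sym2 V → unitInterval) (o : V) (𝒟 : Set (Set V)) (A : Set V) (d : V) (ds : List V) :
    pDecoyList w o 𝒟 A (d :: ds) = (d, pAvoidConst w o 𝒟 d A) :: pDecoyList w o 𝒟 (insert d A) ds := rfl

/-- `pDecoyList` on the empty list. [folklore] -/
@[simp] theorem pDecoyList_nil (w : Sym2 V → unitInterval) (o : V) (𝒟 : Set (Set V)) (A : Set V) :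
    pDecoyList w o 𝒟 A [] = [] := rfl

/-- The decoys of `pDecoyList w o 𝒟 A D` are the members of `D`. [folklore] -/
theorem mem_pDecoyList (w : Sym2 V → unitInterval) (o : V) (𝒟 : Set (Set V)) :
    ∀ (A : Set V) (D : List V) (dc : V × (V → ℝ)), dc ∈ pDecoyList w o 𝒟 A D → dc.1 ∈ D
  | _, [], dc, h => by simp [pDecoyList] at h
  | A, d :: D, dc, h => by
    simp only [pDecoyList, List.mem_cons] at h
    rcases h with rfl | h
    · exact List.mem_cons_self
    · exact List.mem_cons_of_mem _ (mem_pDecoyList w o 𝒟 (insert d A) D dc h)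

/-- The bracket at the first observer: `pCovD g o = μ(R)·∫_{N ∩ {x↔o}} g − μ(N ∩ {x↔o})·∫_R g`. [folklore] -/
theorem pCovD_obs (w : Sym2 V → unitInterval) (o : V) (𝒟 : Set (Set V)) (x : V) (Y : Set V) (g : BondConfig V → ℝ) :
    pCovD w o 𝒟 x Y g o =
      (prodBernoulli w).real ({ω : BondConfig V | ∀ y ∈ Y, ¬ (openGraph ω).Reachable x y} ∩ pocketEv o 𝒟) *
          (∫ ω in {ω : BondConfig V | ∀ y ∈ Y, ¬ (openGraph ω).Reachable x y} ∩ openConn x o, g ω ∂(prodBernoulli w)) -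
        (prodBernoulli w).real ({ω : BondConfig V | ∀ y ∈ Y, ¬ (openGraph ω).Reachable x y} ∩ openConn x o) *
          ∫ ω in {ω : BondConfig V | ∀ y ∈ Y, ¬ (openGraph ω).Reachable x y} ∩ pocketEv o 𝒟, g ω ∂(prodBernoulli w) := by
  simp [pCovD]

/-- The bracket at a pocket label `u ≠ o`: `pCovD g u = μ(R)·∫_{R ∩ {x↔u}} g − μ(R ∩ {x↔u})·∫_R g`. [folklore] -/
theorem pCovD_of_ne (w : Sym2 V → unitInterval) (o : V) (𝒟 : Set (Set V)) (x : V) (Y : Set V) (g : BondConfig V → ℝ) {u : V}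
    (hu : u ≠ o) :
    pCovD w o 𝒟 x Y g u =
      (prodBernoulli w).real ({ω : BondConfig V | ∀ y ∈ Y, ¬ (openGraph ω).Reachable x y} ∩ pocketEv o 𝒟) *
          (∫ ω in {ω : BondConfig V | ∀ y ∈ Y, ¬ (openGraph ω).Reachable x y} ∩ pocketEv o 𝒟 ∩ openConn x u, g ω ∂(prodBernoulli w)) -
        (prodBernoulli w).real ({ω : BondConfig V | ∀ y ∈ Y, ¬ (openGraph ω).Reachable x y} ∩ pocketEv o 𝒟 ∩ openConn x u) *
          ∫ ω in {ω : BondConfig V | ∀ y ∈ Y, ¬ (openGraph ω).Reachable x y} ∩ pocketEv o 𝒟, g ω ∂(prodBernoulli w) := by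
  simp [pCovD, hu]

/-- With no decoys the margin is `pCovD g o − p·pCovD g v`. [folklore] -/
theorem pcshMargin_nil (w : Sym2 V → unitInterval) (o : V) (𝒟 : Set (Set V)) (x : V) (Y : Set V) (v : V) (g : BondConfig V → ℝ) :
    pcshMargin w o 𝒟 x Y [] v g = pCovD w o 𝒟 x Y g o - pObsConst w o 𝒟 v (insert x Y ∪ {d | d ∈ ([] : List V)}) * pCovD w o 𝒟 x Y g v := by
  simp [pcshMargin, CSH.cshMarg]

end PocketCSH

end Summit.CriticalPhenomena.PercolationContinuityZ3.Theorems

end
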